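import Literature.Topology.FourManifolds.TautFoliationsHolonomy
import Literature.Topology.FourManifolds.TautFoliationsLeafPaths
import HarnessLib

/-!
# Foliated maps between `C⁰` codimension-one foliations and the naturality of holonomy

For two `C⁰` codimension-one foliations `F' : Literature.Topology.FourManifolds.Foliation B' X`
and `F : Literature.Topology.FourManifolds.Foliation B M` (leaf models `B'`, `B`, possibly of
different dimensions), a **foliated map** `f : X → M` is a continuous map that is *transversely
étale*: near every point `x`, the transverse coordinate of some flow box of `F'` is a
homeomorphism germ of the transverse coordinate of some flow box of `F` composed with `f`
(`Foliation.IsFoliatedMap`). The motivating instance is the map of a disc in general position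
into a foliated `3`-manifold, from the disc minus the tangency points carrying the induced
(contour) foliation: its levels are, locally, the heights of the flow boxes of the ambient
foliation (Camacho–Lins Neto, *Geometric Theory of Foliations*, Ch. VI §3, Ch. VII §2: the
holonomy of a closed orbit of the induced foliation is the holonomy of its image curve).

* `IsFoliatedMap.exists_compat` (**proved**): the defining condition holds for *every* flow box
  of `F'` around `x` and *every* flow box of `F` around `f x` (transition germs are
  homeomorphism germs).
* `IsFoliatedMap.continuous_leafMap`, `IsFoliatedMap.mapsTo_leaf` (**proved**): a foliated map
  is continuous for the leaf topologies and maps leaves into leaves.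
* `IsFoliatedMap.pushGerm` (**definition**) and its API (**proved**): the push-forward
  `F'.GermSpace → F.GermSpace` of distinguished germs — the germ of a local first integral of
  `F'` at `x` is `G ∘ f` for a unique distinguished germ `G` of `F` at `f x`
  (`exists_pushGerm_germ`, `pushGerm_germ_unique`); it preserves levels and is **continuous**
  for the étalé topologies (`continuous_pushGerm`), hence maps lifts of leaf paths to lifts of
  their images (`pushGerm_liftPath`).
* `GermSpace.postcomp` (**definition**): post-composition of distinguished germs with a
  homeomorphism germ of the line, continuous where defined (`continuousOn_postcomp`); it
  intertwines the lifts from two starting germs over the same point (`postcomp_liftPath`).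
* **Naturality of holonomy** (`IsFoliatedMap.holonomyGerm_comp_eventuallyEq`, **proved**): if
  `h_{c₀} = ι ∘ h_{e₀} ∘ f` near `x₀`, the holonomy germ of `F'` along a leaf loop `γ` at `x₀`,
  read in `c₀`, is the `ι`-conjugate of the holonomy germ of `F` along `f ∘ γ` read in `e₀`:
  `ψ' ∘ ι = ι ∘ ψ` near `h_{e₀}(f x₀)`. In particular (`holonomyGerm_eq_id_of_map_homotopic_refl`)
  **a leaf loop whose image is null-homotopic in its leaf of `F` has trivial holonomy in `F'`**
  — the step "closed orbits of the induced foliation whose images are homotopic to constants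
  in their leaves have trivial holonomy" of Camacho–Lins Neto, Ch. VII §2, Prop. 1.

## References

* C. Camacho, A. Lins Neto, *Geometric Theory of Foliations*, Birkhäuser (1985), Ch. II §1
  (morphisms of foliations), Ch. IV §1 (holonomy), Ch. VII §2 [CamachoLinsNeto1985].
* G. Hector, U. Hirsch, *Introduction to the Geometry of Foliations, Part A*, 2nd ed., Vieweg
  (1986), Ch. II 2.1.6, Ch. III 1.2–1.3, 2.1–2.2 [HectorHirsch1986].

## Design notes

* The compatibility is required at each point for *some* pair of boxes and is then proved
  for all pairs; the homeomorphism germ `φ` is not required to be increasing (orientation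
  bookkeeping is left to users; conjugation preserves triviality of holonomy regardless).
* Germs are Mathlib's `Filter.Germ (𝓝 x) ℝ`; `G ∘ f` is `Filter.Germ.compTendsto`.
-/

open Set Filter Function Topology unitInterval

namespace Literature.Topology.FourManifolds

namespace Foliation

variable {B : Type*} [TopologicalSpace B] {M : Type*} [TopologicalSpace M]
variable {B' : Type*} [TopologicalSpace B'] {X : Type*} [TopologicalSpace X]
variable (F' : Foliation B' X) (F : Foliation B M)

/-! ## Foliated maps -/

/-- A **foliated map** (transversely étale morphism of `C⁰` codimension-one foliations) from
`(X, F')` to `(M, F)`: a continuous map `f : X → M` such that near every point `x` the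
transverse coordinate `h_c` of some flow box `c ∋ x` of `F'` is `φ ∘ h_e ∘ f` for some flow box
`e ∋ f x` of `F` and some homeomorphism germ `φ` of the line at `h_e (f x)` — `f` maps plaques
into plaques and is a local homeomorphism on transversals (Camacho–Lins Neto, Ch. II §1;
Hector–Hirsch A, Ch. II 2.1.6 (vi)). [cite: HectorHirsch1986, Ch. II 2.1.6] -/
structure IsFoliatedMap (f : X → M) : Prop where
  /-- A foliated map is continuous. -/
  continuous : Continuous f
  /-- Near each point, some transverse coordinate of `F'` is a homeomorphism germ of a
  transverse coordinate of `F` composed with `f`. -/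
  compat : ∀ x, ∃ c ∈ F'.atlas, x ∈ c.source ∧ ∃ e ∈ F.atlas, f x ∈ e.source ∧
    ∃ φ : ℝ → ℝ, IsHomeoGermAt φ (e (f x)).2 ∧ height c =ᶠ[𝓝 x] φ ∘ height e ∘ f

/-- The induced map of leaf spaces (the same map, between the leaf topologies). [folklore] -/
def leafMap (f : X → M) : F'.LeafSpace → F.LeafSpace := fun p ↦ toLeafSpace (f (ofLeafSpace p))

/-- Unfolding lemma for `leafMap`. [folklore] -/
@[simp] theorem ofLeafSpace_leafMap (f : X → M) (p : F'.LeafSpace) :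
    ofLeafSpace (leafMap F' F f p) = f (ofLeafSpace p) := rfl

/-- `leafMap` on `toLeafSpace x`. [folklore] -/
@[simp] theorem leafMap_toLeafSpace (f : X → M) (x : X) :
    leafMap F' F f (toLeafSpace x) = toLeafSpace (f x) := rfl

namespace IsFoliatedMap

variable {F' F} {f : X → M} {x : X} {c c₀ : OpenPartialHomeomorph X (B' × ℝ)}
  {e e₀ : OpenPartialHomeomorph M (B × ℝ)}

/-- The value of the homeomorphism germ at the base height: `φ (h_e (f x)) = h_c x`.
[folklore] -/
theorem apply_height_eq {φ : ℝ → ℝ} (h : height c =ᶠ[𝓝 x] φ ∘ height e ∘ f) :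
    φ (e (f x)).2 = (c x).2 :=
  (h.eq_of_nhds : height c x = (φ ∘ height e ∘ f) x).symm

/-- `h_e ∘ f` tends to `h_e (f x)` at `x`. [folklore] -/
theorem tendsto_height_comp (hf : IsFoliatedMap F' F f) (hx : f x ∈ e.source) :
    Tendsto (height e ∘ f) (𝓝 x) (𝓝 (e (f x)).2) :=
  (tendsto_height hx).comp (hf.continuous.tendsto x)

/-- **Inverting the compatibility**: if `h_c = φ ∘ h_e ∘ f` near `x` and `ψ` is the inverse
germ of `φ`, then `h_e ∘ f = ψ ∘ h_c` near `x`. [folklore] -/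
theorem height_comp_eventuallyEq (hf : IsFoliatedMap F' F f) (hx : f x ∈ e.source) {φ ψ : ℝ → ℝ}
    (h : height c =ᶠ[𝓝 x] φ ∘ height e ∘ f) (hψφ : ψ ∘ φ =ᶠ[𝓝 (e (f x)).2] id) :
    height e ∘ f =ᶠ[𝓝 x] ψ ∘ height c := by
  have h₁ : (ψ ∘ φ) ∘ (height e ∘ f) =ᶠ[𝓝 x] id ∘ (height e ∘ f) :=
    hψφ.comp_tendsto (hf.tendsto_height_comp hx)
  filter_upwards [h, h₁] with y hy hy₁
  simp only [comp_apply, id_eq] at hy hy₁ ⊢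
  rw [hy, hy₁]

/-- **The compatibility holds in all boxes**: for a foliated map, *every* flow box `c ∋ x` of
`F'` and *every* flow box `e ∋ f x` of `F` satisfy `h_c = φ ∘ h_e ∘ f` near `x` for a suitable
homeomorphism germ `φ` at `h_e (f x)` (compose the given germ with the transition germs
`γ_{c' c}` of `F'` and `γ_{e e'}` of `F`, homeomorphism germs). [folklore] -/
theorem exists_compat (hf : IsFoliatedMap F' F f) (hc : c ∈ F'.atlas) (hxc : x ∈ c.source)
    (he : e ∈ F.atlas) (hxe : f x ∈ e.source) :
    ∃ φ : ℝ → ℝ, IsHomeoGermAt φ (e (f x)).2 ∧ height c =ᶠ[𝓝 x] φ ∘ height e ∘ f := by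
  obtain ⟨c', hc', hxc', e', he', hxe', φ, hφ, hcomp⟩ := hf.compat x
  refine ⟨transition c' c x ∘ φ ∘ transition e e' (f x), ?_, ?_⟩
  · have h₁ : IsHomeoGermAt (transition e e' (f x)) (e (f x)).2 :=
      F.isHomeoGermAt_transition he he' hxe hxe'
    have h₂ : IsHomeoGermAt φ (transition e e' (f x) (e (f x)).2) := by
      rwa [transition_apply_height e' hxe]
    have h₃ : IsHomeoGermAt (transition c' c x) ((φ ∘ transition e e' (f x)) (e (f x)).2) := by
      rw [comp_apply, transition_apply_height e' hxe, apply_height_eq hcomp]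
      exact F'.isHomeoGermAt_transition hc' hc hxc' hxc
    exact h₃.comp (h₂.comp h₁)
  · have h₁ : height c =ᶠ[𝓝 x] transition c' c x ∘ height c' :=
      F'.height_eventuallyEq_transition_comp_height hc' hc hxc' hxc
    have h₂ : height e' ∘ f =ᶠ[𝓝 x] (transition e e' (f x) ∘ height e) ∘ f :=
      (F.height_eventuallyEq_transition_comp_height he he' hxe hxe').comp_tendsto
        (hf.continuous.tendsto x)
    filter_upwards [h₁, h₂, hcomp] with y hy₁ hy₂ hy₃
    simp only [comp_apply] at hy₁ hy₂ hy₃ ⊢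
    rw [hy₁, hy₃, hy₂]

/-! ## Foliated maps are leaf maps -/

/-- **A foliated map is continuous for the leaf topologies** (it is continuous and, along the
leaf topology of `X`, the transverse coordinate `h_e ∘ f = ψ ∘ h_c` is locally constant).
[folklore] -/
theorem continuous_leafMap (hf : IsFoliatedMap F' F f) : Continuous (leafMap F' F f) := by
  have hg : Continuous (f ∘ (ofLeafSpace : F'.LeafSpace → X)) :=
    hf.continuous.comp F'.continuous_ofLeafSpace
  refine F.continuous_toLeafSpace_comp_of_exists hg fun a ↦ ?_
  obtain ⟨c, hc, hxc, e, he, hxe, φ, hφ, hcomp⟩ := hf.compat (ofLeafSpace a)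
  refine ⟨e, he, hxe, ?_⟩
  obtain ⟨U, hU, hinj⟩ := hφ.eventually_injective
  -- along the leaf topology the `c`-height is locally constant
  have hid : Continuous (toLeafSpace ∘ (ofLeafSpace : F'.LeafSpace → X) : F'.LeafSpace → F'.LeafSpace) :=
    continuous_id
  have h₁ : ∀ᶠ b in 𝓝 a, (c (ofLeafSpace b)).2 = (c (ofLeafSpace a)).2 :=
    F'.eventually_height_eq_of_continuousAt hid.continuousAt hc hxc
  -- the compatibility, transported to the (finer) leaf topology
  have h₂ : ∀ᶠ b in 𝓝 a, height c (ofLeafSpace b) = (φ ∘ height e ∘ f) (ofLeafSpace b) :=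
    (F'.continuous_ofLeafSpace.tendsto a).eventually hcomp
  -- the `e`-heights of `f` stay in the injectivity neighbourhood of `φ`
  have h₃ : ∀ᶠ b in 𝓝 a, height e (f (ofLeafSpace b)) ∈ U :=
    ((hf.tendsto_height_comp hxe).comp (F'.continuous_ofLeafSpace.tendsto a)).eventually
      (eventually_mem_set.2 hU)
  have ha : height e (f (ofLeafSpace a)) ∈ U := mem_of_mem_nhds hU
  have hca : height c (ofLeafSpace a) = φ (height e (f (ofLeafSpace a))) := hcomp.eq_of_nhds
  filter_upwards [h₁, h₂, h₃] with b hb₁ hb₂ hb₃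
  refine hinj hb₃ ha ?_
  have : height c (ofLeafSpace b) = height c (ofLeafSpace a) := hb₁
  rw [hb₂, hca] at this
  exact this

/-- **A foliated map sends leaves into leaves.** [folklore] -/
theorem mapsTo_leaf [PreconnectedSpace B'] (hf : IsFoliatedMap F' F f) (x : X) :
    MapsTo f (F'.leaf x) (F.leaf (f x)) := by
  intro y hy
  have hg : Continuous (toLeafSpace ∘ (fun p : F'.Leaf x ↦ f (ofLeafSpace (p : F'.LeafSpace))) :
      F'.Leaf x → F.LeafSpace) :=
    hf.continuous_leafMap.comp continuous_subtype_val
  exact F.mem_leaf_of_continuous_toLeafSpace hg (Leaf.base F' x) (Leaf.mk y hy)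

/-- The image of a leaf is contained in the leaf of the image. [folklore] -/
theorem image_leaf_subset [PreconnectedSpace B'] (hf : IsFoliatedMap F' F f) (x : X) :
    f '' F'.leaf x ⊆ F.leaf (f x) :=
  (hf.mapsTo_leaf x).image_subset

/-! ## Push-forward of distinguished germs -/

/-- **Existence of the pushed germ**: a distinguished germ `G'` of `F'` at `x` is `G ∘ f` for
some distinguished germ `G` of `F` at `f x` (write `G' = χ ∘ h_c` in a compatible box `c`,
then `G = (χ ∘ φ) ∘ h_e`). [folklore] -/
theorem exists_pushGerm_germ (hf : IsFoliatedMap F' F f) {G' : Germ (𝓝 x) ℝ}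
    (hG' : F'.IsDistinguishedGerm x G') :
    ∃ G : Germ (𝓝 (f x)) ℝ, F.IsDistinguishedGerm (f x) G ∧
      G.compTendsto f (hf.continuous.tendsto x) = G' := by
  obtain ⟨c, hc, hxc, e, he, hxe, φ, hφ, hcomp⟩ := hf.compat x
  obtain ⟨χ, hχ, rfl⟩ := hG'.exists_eq hc hxc
  refine ⟨↑((χ ∘ φ) ∘ height e), ?_, ?_⟩
  · refine F.isDistinguishedGerm_comp_height he hxe (IsHomeoGermAt.comp ?_ hφ)
    rwa [apply_height_eq hcomp]
  · rw [Germ.coe_compTendsto, Germ.coe_eq]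
    filter_upwards [hcomp] with y hy
    simp only [comp_apply] at hy ⊢
    rw [hy]

/-- **Uniqueness of the pushed germ**: two distinguished germs of `F` at `f x` which agree
after composition with `f` are equal — the transverse coordinate `h_e ∘ f = ψ ∘ h_c` takes
near `x` every value near `h_e (f x)`, so representatives `α₁ ∘ h_e`, `α₂ ∘ h_e` with
`α₁ ∘ h_e ∘ f = α₂ ∘ h_e ∘ f` near `x` have `α₁ = α₂` near `h_e (f x)`. [folklore] -/
theorem pushGerm_germ_unique (hf : IsFoliatedMap F' F f) {G₁ G₂ : Germ (𝓝 (f x)) ℝ}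
    (h₁ : F.IsDistinguishedGerm (f x) G₁) (h₂ : F.IsDistinguishedGerm (f x) G₂)
    (h : G₁.compTendsto f (hf.continuous.tendsto x) = G₂.compTendsto f (hf.continuous.tendsto x)) :
    G₁ = G₂ := by
  obtain ⟨c, hc, hxc, e, he, hxe, φ, hφ, hcomp⟩ := hf.compat x
  obtain ⟨α₁, -, rfl⟩ := h₁.exists_eq he hxe
  obtain ⟨α₂, -, rfl⟩ := h₂.exists_eq he hxe
  rw [Germ.coe_compTendsto, Germ.coe_compTendsto, Germ.coe_eq] at h
  obtain ⟨ψ, hψ, hψt, hψφ, -⟩ := hφ.exists_inverse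
  have hef : height e ∘ f =ᶠ[𝓝 x] ψ ∘ height c := hf.height_comp_eventuallyEq hxe hcomp hψφ
  -- `(α₁ ∘ ψ) ∘ h_c = (α₂ ∘ ψ) ∘ h_c` near `x`
  have hc' : (↑((α₁ ∘ ψ) ∘ height c) : Germ (𝓝 x) ℝ) = ↑((α₂ ∘ ψ) ∘ height c) := by
    rw [Germ.coe_eq]
    filter_upwards [h, hef] with y hy hy'
    simp only [comp_apply] at hy hy' ⊢
    rw [← hy', hy]
  have hα : α₁ ∘ ψ =ᶠ[𝓝 (c x).2] α₂ ∘ ψ := F'.eventuallyEq_of_comp_height_eq hc hxc hc'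
  -- compose back with `φ`
  have hφt : Tendsto φ (𝓝 (e (f x)).2) (𝓝 (c x).2) := by
    have h := hφ.continuousAt
    rwa [ContinuousAt, apply_height_eq hcomp] at h
  have hα' : α₁ =ᶠ[𝓝 (e (f x)).2] α₂ := by
    filter_upwards [hα.comp_tendsto hφt, hψφ] with s hs hs'
    simp only [comp_apply, id_eq] at hs hs'
    rwa [hs'] at hs
  rw [Germ.coe_eq]
  exact hα'.comp_tendsto (tendsto_height hxe)

/-- **The push-forward of distinguished germs** along a foliated map: the point of the germ
space of `F` over `f x` whose germ `G` satisfies `G ∘ f = d.germ`. [folklore] -/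
noncomputable def pushGerm (hf : IsFoliatedMap F' F f) (d : F'.GermSpace) : F.GermSpace :=
  ⟨leafMap F' F f d.pt, Classical.choose (hf.exists_pushGerm_germ d.isDist),
    (Classical.choose_spec (hf.exists_pushGerm_germ d.isDist)).1⟩

/-- The base point of the pushed germ. [folklore] -/
@[simp] theorem pushGerm_pt (hf : IsFoliatedMap F' F f) (d : F'.GermSpace) :
    (hf.pushGerm d).pt = leafMap F' F f d.pt := rfl

/-- The projection of the pushed germ. [folklore] -/
@[simp] theorem proj_pushGerm (hf : IsFoliatedMap F' F f) (d : F'.GermSpace) :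
    (hf.pushGerm d).proj = leafMap F' F f d.proj := rfl

/-- The base point of the pushed germ, in `M`. [folklore] -/
theorem ofLeafSpace_pushGerm_pt (hf : IsFoliatedMap F' F f) (d : F'.GermSpace) :
    ofLeafSpace (hf.pushGerm d).pt = f (ofLeafSpace d.pt) := rfl

/-- **The defining property of the pushed germ**: composed with `f` it is the given germ.
[folklore] -/
theorem pushGerm_germ_compTendsto (hf : IsFoliatedMap F' F f) (d : F'.GermSpace) :
    (hf.pushGerm d).germ.compTendsto f (hf.continuous.tendsto (ofLeafSpace d.pt)) = d.germ :=
  (Classical.choose_spec (hf.exists_pushGerm_germ d.isDist)).2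

/-- **Characterisation of the pushed germ by representatives**: if `g : M → ℝ` has a
distinguished germ at `f x` and `d.germ` is the germ of `g ∘ f`, then the pushed germ is the
germ of `g`. [folklore] -/
theorem pushGerm_germ_eq_coe (hf : IsFoliatedMap F' F f) (d : F'.GermSpace) {g : M → ℝ}
    (hg : F.IsDistinguishedGerm (f (ofLeafSpace d.pt)) ↑g)
    (hd : d.germ = ↑(g ∘ f)) : (hf.pushGerm d).germ = ↑g := by
  refine hf.pushGerm_germ_unique (hf.pushGerm d).isDist hg ?_
  calc _ = d.germ := hf.pushGerm_germ_compTendsto d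
    _ = _ := by rw [hd]; rfl

/-- **The push-forward preserves levels** (the value of `G` at `f x` is that of `G ∘ f` at
`x`). [folklore] -/
@[simp] theorem level_pushGerm (hf : IsFoliatedMap F' F f) (d : F'.GermSpace) :
    GermSpace.level (hf.pushGerm d) = GermSpace.level d := by
  obtain ⟨g, hg⟩ := Quot.exists_rep (hf.pushGerm d).germ
  have hg' : (hf.pushGerm d).germ = ↑g := hg.symm
  have hd : d.germ = ↑(g ∘ f) := by
    rw [← hf.pushGerm_germ_compTendsto d, hg', Germ.coe_compTendsto]
  unfold GermSpace.level
  rw [hg', hd]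
  rfl

/-- The push-forward of the germ of `h_c` when `h_c = φ ∘ h_e ∘ f` near `x`: the germ of
`φ ∘ h_e`. [folklore] -/
theorem pushGerm_ofHeight (hf : IsFoliatedMap F' F f) (hc : c ∈ F'.atlas) (hxc : x ∈ c.source)
    (he : e ∈ F.atlas) (hxe : f x ∈ e.source) {φ : ℝ → ℝ} (hφ : IsHomeoGermAt φ (e (f x)).2)
    (hcomp : height c =ᶠ[𝓝 x] φ ∘ height e ∘ f) :
    (hf.pushGerm (GermSpace.ofHeight F' hc (toLeafSpace x) hxc)).germ = ↑(φ ∘ height e) :=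
  hf.pushGerm_germ_eq_coe _ (F.isDistinguishedGerm_comp_height he hxe hφ) (Germ.coe_eq.2 hcomp)

/-! ## Continuity of the push-forward -/

/-- **The push-forward of germs is continuous** for the étalé topologies: along the section
`b ↦ germ (χ ∘ h_c)` of `F'` over a plaque of `c`, near a parameter `b₀` with compatible box
`e` of `F` at the image point (`h_c = φ ∘ h_e ∘ f` on an open set), the pushed germs are the
section `germ ((χ ∘ φ) ∘ h_e)` of `F` over the plaque of `e` through the image, taken at the
`B`-coordinate of `f` — a continuous map. [folklore] -/
theorem continuous_pushGerm (hf : IsFoliatedMap F' F f) : Continuous hf.pushGerm := by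
  refine GermSpace.continuous_iff.2 fun c hc t χ hχ ↦ continuous_iff_continuousAt.2 fun b₀ ↦ ?_
  -- the point of the plaque and a compatible box of `F` at its image
  have hx₀c : plaqueMap c t b₀ ∈ c.source := F'.plaqueMap_mem_source hc t b₀
  obtain ⟨e, he, hx₀e⟩ := F.exists_mem_source (f (plaqueMap c t b₀))
  obtain ⟨φ, hφ, hcomp⟩ := hf.exists_compat hc hx₀c he hx₀e
  obtain ⟨N, hN, hNo, hx₀N⟩ := eventually_nhds_iff.1 hcomp
  have hct : (c (plaqueMap c t b₀)).2 = t := by rw [F'.apply_plaqueMap hc]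
  have hχφ : IsHomeoGermAt (χ ∘ φ) (e (f (plaqueMap c t b₀))).2 := by
    refine IsHomeoGermAt.comp ?_ hφ
    rw [apply_height_eq hcomp, hct]
    exact hχ
  -- the comparison section of `F`, continuous at `b₀`
  generalize ht₀ : (e (f (plaqueMap c t b₀))).2 = t₀ at hχφ
  set g : B' → F.GermSpace := fun b ↦ F.germSection he t₀ hχφ (e (f (plaqueMap c t b))).1 with hgdef
  have hc₃ : ContinuousAt (fun b ↦ e (f (plaqueMap c t b))) b₀ :=
    ContinuousAt.comp (f := f ∘ plaqueMap c t) (e.continuousAt hx₀e)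
      (hf.continuous.comp (F'.continuous_plaqueMap hc t)).continuousAt
  have hg : ContinuousAt g b₀ :=
    (F.continuous_germSection he t₀ hχφ).continuousAt.comp (continuous_fst.continuousAt.comp hc₃)
  refine hg.congr ?_
  -- parameters near `b₀`: image on the plaque of `e` at height `t₀`, point in `N`
  have h₁ : ∀ᶠ b in 𝓝 b₀, f (plaqueMap c t b) ∈ plaque e t₀ := by
    have hlm : Continuous (toLeafSpace ∘ (fun b ↦ f (plaqueMap c t b)) : B' → F.LeafSpace) :=
      hf.continuous_leafMap.comp (F'.continuous_leafPlaqueMap hc t)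
    have h := F.eventually_mem_plaque_of_continuousAt hlm.continuousAt he hx₀e
    simp only [ht₀] at h
    exact h
  have h₂ : ∀ᶠ b in 𝓝 b₀, plaqueMap c t b ∈ N :=
    (F'.continuous_plaqueMap hc t).continuousAt.preimage_mem_nhds (hNo.mem_nhds hx₀N)
  filter_upwards [h₁, h₂] with b hb₁ hb₂
  -- the pushed germ of the section at `b` is `(χ ∘ φ) ∘ h_e`
  have hχφb : IsHomeoGermAt (χ ∘ φ) (e (f (plaqueMap c t b))).2 := by
    rw [hb₁.2]
    exact hχφ
  have hgerm : (hf.pushGerm (F'.germSection hc t hχ b)).germ = ↑((χ ∘ φ) ∘ height e) := by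
    refine hf.pushGerm_germ_eq_coe _ (F.isDistinguishedGerm_comp_height he hb₁.1 hχφb) ?_
    show ((↑(χ ∘ height c)) : Germ (𝓝 (plaqueMap c t b)) ℝ) = ↑(((χ ∘ φ) ∘ height e) ∘ f)
    rw [Germ.coe_eq]
    filter_upwards [hNo.mem_nhds hb₂] with y hy
    simp only [comp_apply]
    rw [hN y hy]
    rfl
  -- hence it is the value of the comparison section
  symm
  refine GermSpace.ext_heq ?_ ?_
  · exact (congrArg toLeafSpace (plaqueMap_fst_eq hb₁)).symm
  · show HEq (hf.pushGerm (F'.germSection hc t hχ b)).germ (g b).germ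
    rw [hgerm]
    exact GermSpace.coe_germ_heq (plaqueMap_fst_eq hb₁).symm _

/-- **The push-forward maps lifts to lifts**: for a leaf path `γ` of `F'` and a starting germ
`d₀` over `γ 0`, the push-forward of the lift of `γ` from `d₀` is the lift of the image path
from the pushed germ (uniqueness of lifts in the germ covering of `F`). [folklore] -/
theorem pushGerm_liftPath [Nonempty B'] [LocallyConnectedSpace B'] [Nonempty B]
    [LocallyConnectedSpace B] (hf : IsFoliatedMap F' F f) {p q : F'.LeafSpace} (γ : Path p q)
    (d₀ : F'.GermSpace) (h₀ : γ 0 = d₀.proj) :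
    (⟨hf.pushGerm, hf.continuous_pushGerm⟩ : C(F'.GermSpace, F.GermSpace)).comp
        ((F'.isCoveringMap_proj).liftPath γ d₀ h₀) =
      (F.isCoveringMap_proj).liftPath (γ.map hf.continuous_leafMap) (hf.pushGerm d₀)
        (by show leafMap F' F f (γ 0) = leafMap F' F f d₀.proj; rw [h₀]) := by
  rw [(F.isCoveringMap_proj).eq_liftPath_iff']
  refine ⟨funext fun s ↦ ?_, ?_⟩
  · exact congrArg (leafMap F' F f) (congr_fun ((F'.isCoveringMap_proj).liftPath_lifts γ d₀ h₀) s)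
  · show hf.pushGerm (((F'.isCoveringMap_proj).liftPath γ d₀ h₀) 0) = hf.pushGerm d₀
    rw [(F'.isCoveringMap_proj).liftPath_zero]

end IsFoliatedMap

/-! ## Post-composition of distinguished germs with a homeomorphism germ of the line -/

namespace GermSpace

variable {F}

/-- Post-composing a distinguished germ with a homeomorphism germ of the line at its value gives
a distinguished germ. [folklore] -/
theorem isDistinguishedGerm_map {z : M} {G : Germ (𝓝 z) ℝ} (hG : F.IsDistinguishedGerm z G)
    {ι : ℝ → ℝ} (hι : IsHomeoGermAt ι G.value) : F.IsDistinguishedGerm z (G.map ι) := by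
  obtain ⟨e, he, hz, φ, hφ, rfl⟩ := hG
  rw [Germ.map_coe]
  exact F.isDistinguishedGerm_comp_height he hz (IsHomeoGermAt.comp hι hφ)

open Classical in
/-- **Post-composition with a homeomorphism germ `ι` of the line**: the distinguished germ `G`
at level `τ` is sent to `ι ∘ G` (at level `ι τ`) when `ι` is a homeomorphism germ at `τ`, and
is left unchanged otherwise. On the germs of level `τ₀` this is the change of the normalising
transversal coordinate (Hector–Hirsch A, Ch. III 1.3). [folklore] -/
noncomputable def postcomp (ι : ℝ → ℝ) (d : F.GermSpace) : F.GermSpace :=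
  if h : IsHomeoGermAt ι (level d) then ⟨d.pt, d.germ.map ι, isDistinguishedGerm_map d.isDist h⟩
  else d

/-- `postcomp` where `ι` is a homeomorphism germ at the level. [folklore] -/
theorem postcomp_eq_mk {ι : ℝ → ℝ} {d : F.GermSpace} (h : IsHomeoGermAt ι (level d)) :
    postcomp ι d = ⟨d.pt, d.germ.map ι, isDistinguishedGerm_map d.isDist h⟩ :=
  dif_pos h

/-- `postcomp` does not move base points. [folklore] -/
@[simp] theorem postcomp_pt (ι : ℝ → ℝ) (d : F.GermSpace) : (postcomp ι d).pt = d.pt := by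
  unfold postcomp
  split_ifs <;> rfl

/-- `postcomp` lies over the identity of the leaf space. [folklore] -/
@[simp] theorem proj_postcomp (ι : ℝ → ℝ) (d : F.GermSpace) : (postcomp ι d).proj = d.proj :=
  postcomp_pt ι d

/-- The level of `postcomp ι d` is `ι (level d)`. [folklore] -/
theorem level_postcomp {ι : ℝ → ℝ} {d : F.GermSpace} (h : IsHomeoGermAt ι (level d)) :
    level (postcomp ι d) = ι (level d) := by
  rw [postcomp_eq_mk h]
  obtain ⟨q, G, hG⟩ := d
  induction G using Germ.inductionOn with
  | h g => rfl

/-- `postcomp` along a section of local first integrals is the section of the post-composed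
first integral. [folklore] -/
theorem postcomp_germSection {e : OpenPartialHomeomorph M (B × ℝ)} (he : e ∈ F.atlas) (t : ℝ)
    {φ : ℝ → ℝ} (hφ : IsHomeoGermAt φ t) {ι : ℝ → ℝ} (hι : IsHomeoGermAt ι (φ t)) (b : B) :
    postcomp ι (F.germSection he t hφ b) = F.germSection he t (hι.comp hφ) b := by
  have h : IsHomeoGermAt ι (level (F.germSection he t hφ b)) := by rwa [level_germSection]
  rw [postcomp_eq_mk h]
  rfl

/-- The germs at whose level `ι` is a homeomorphism germ form an open set (the level is locally
constant). [folklore] -/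
theorem isOpen_setOf_isHomeoGermAt_level (ι : ℝ → ℝ) :
    IsOpen {d : F.GermSpace | IsHomeoGermAt ι (level d)} :=
  isLocallyConstant_level {τ | IsHomeoGermAt ι τ}

/-- **`postcomp ι` is continuous where `ι` is a homeomorphism germ at the level** (along a
section it is a section). [folklore] -/
theorem continuousOn_postcomp (ι : ℝ → ℝ) :
    ContinuousOn (postcomp ι) {d : F.GermSpace | IsHomeoGermAt ι (level d)} := by
  refine (GermSpace.continuousOn_iff (isOpen_setOf_isHomeoGermAt_level ι)).2 fun e he t φ hφ ↦ ?_
  by_cases hι : IsHomeoGermAt ι (φ t)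
  · have heq : postcomp ι ∘ F.germSection he t hφ = F.germSection he t (hι.comp hφ) :=
      funext fun b ↦ postcomp_germSection he t hφ hι b
    rw [heq]
    exact (F.continuous_germSection he t _).continuousOn
  · have hempty : F.germSection he t hφ ⁻¹' {d : F.GermSpace | IsHomeoGermAt ι (level d)} = ∅ :=
      eq_empty_of_forall_notMem fun b hb ↦ hι (by simpa using hb)
    rw [hempty]
    exact continuousOn_empty _

/-- A continuous family of germs of constant level `τ₀`, with `ι` a homeomorphism germ at `τ₀`,
stays continuous after `postcomp ι`. [folklore] -/
theorem continuous_postcomp_comp {A : Type*} [TopologicalSpace A] {ι : ℝ → ℝ} (Γ : C(A, F.GermSpace))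
    (hΓ : ∀ a, IsHomeoGermAt ι (level (Γ a))) : Continuous (postcomp ι ∘ Γ) :=
  (continuousOn_postcomp ι).comp_continuous Γ.continuous hΓ

end GermSpace

/-! ## Naturality of holonomy under foliated maps -/

namespace IsFoliatedMap

variable {F' F} {f : X → M} {c₀ : OpenPartialHomeomorph X (B' × ℝ)} {e₀ : OpenPartialHomeomorph M (B × ℝ)}

/-- Reading germs through a box is compatible with equality of points of the germ space (a
dependent rewriting lemma). [folklore] -/
theorem readGerm_eq_of_eq {e : OpenPartialHomeomorph M (B × ℝ)} (he : e ∈ F.atlas) {t : ℝ}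
    {d d' : F.GermSpace} (h : d = d') (hz : ofLeafSpace d.pt ∈ plaque e t)
    (hz' : ofLeafSpace d'.pt ∈ plaque e t) : F.readGerm he hz d.germ = F.readGerm he hz' d'.germ := by
  subst h
  rfl

variable [Nonempty B'] [LocallyConnectedSpace B'] [Nonempty B] [LocallyConnectedSpace B]

/-- **Naturality of holonomy under foliated maps.** Let `f` be a foliated map, `x₀` a point,
`c₀ ∋ x₀` and `e₀ ∋ f x₀` flow boxes with `h_{c₀} = ι ∘ h_{e₀} ∘ f` near `x₀` for a
homeomorphism germ `ι`, and `γ` a leaf loop of `F'` at `x₀`. If `ψ` represents the holonomy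
germ of `F` along `f ∘ γ` read in `e₀` and `ψ'` that of `F'` along `γ` read in `c₀`, then
`ψ' ∘ ι = ι ∘ ψ` near `h_{e₀}(f x₀)`: the holonomy of the image curve is the holonomy of the
curve, conjugated by the identification `ι` of the transversals (Camacho–Lins Neto, Ch. VII
§2, proof of Prop. 1: the holonomy of a closed orbit of `g^*𝓕` is that of its image; Ch. IV §1,
Remark). Proof: the push-forward of the lift of `γ` from `germ h_{c₀}` and the `ι`-post-composed
lift of `f ∘ γ` from `germ h_{e₀}` are lifts of `f ∘ γ` from the same germ `ι ∘ h_{e₀}`, hence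
equal; compare their end germs read through `e₀`. [cite: CamachoLinsNeto1985, Ch. IV §1] -/
theorem holonomyGerm_comp_eventuallyEq (hf : IsFoliatedMap F' F f) {x₀ : X}
    (hc₀ : c₀ ∈ F'.atlas) (hx₀ : x₀ ∈ c₀.source) (he₀ : e₀ ∈ F.atlas) (hfx₀ : f x₀ ∈ e₀.source)
    {ι : ℝ → ℝ} (hι : IsHomeoGermAt ι (e₀ (f x₀)).2) (hcomp : height c₀ =ᶠ[𝓝 x₀] ι ∘ height e₀ ∘ f)
    (γ : Path (toLeafSpace x₀ : F'.LeafSpace) (toLeafSpace x₀)) {ψ ψ' : ℝ → ℝ}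
    (hψ : F.holonomyGerm he₀ hfx₀ (Path.Homotopic.Quotient.mk (γ.map hf.continuous_leafMap))
      he₀ hfx₀ = ↑ψ)
    (hψ' : F'.holonomyGerm hc₀ hx₀ (Path.Homotopic.Quotient.mk γ) hc₀ hx₀ = ↑ψ') :
    ψ' ∘ ι =ᶠ[𝓝 (e₀ (f x₀)).2] ι ∘ ψ := by
  set Γ' : C(I, F'.GermSpace) := (F'.isCoveringMap_proj).liftPath γ
    (GermSpace.ofHeight F' hc₀ (toLeafSpace x₀) hx₀) γ.source with hΓ'
  set Γ : C(I, F.GermSpace) := (F.isCoveringMap_proj).liftPath (γ.map hf.continuous_leafMap)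
    (GermSpace.ofHeight F he₀ (leafMap F' F f (toLeafSpace x₀)) hfx₀)
    (γ.map hf.continuous_leafMap).source with hΓ
  have hιt : ι (e₀ (f x₀)).2 = (c₀ x₀).2 := apply_height_eq hcomp
  -- `ψ'` is a homeomorphism germ
  have hψ'h : IsHomeoGermAt ψ' (c₀ x₀).2 := by
    obtain ⟨ψ'', hψ''h, hψ'', -⟩ := F'.exists_isHomeoGermAt_holonomyGerm_eq hc₀ hx₀
      (Path.Homotopic.Quotient.mk γ) hc₀ hx₀
    rw [hψ'] at hψ''
    exact hψ''h.congr (Germ.coe_eq.1 hψ'').symm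
  -- levels along `Γ`
  have hlevΓ : ∀ s, GermSpace.level (Γ s) = (e₀ (f x₀)).2 := fun s ↦ by
    rw [GermSpace.level_apply_eq_of_path Γ s 0, (F.isCoveringMap_proj).liftPath_zero,
      GermSpace.level_ofHeight]
    rfl
  -- the two lifts of `f ∘ γ` from `ι ∘ h_{e₀}` agree
  have hstart : hf.pushGerm (GermSpace.ofHeight F' hc₀ (toLeafSpace x₀) hx₀) =
      GermSpace.postcomp ι (GermSpace.ofHeight F he₀ (leafMap F' F f (toLeafSpace x₀)) hfx₀) := by
    rw [GermSpace.postcomp_eq_mk (show IsHomeoGermAt ι (GermSpace.level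
      (GermSpace.ofHeight F he₀ (leafMap F' F f (toLeafSpace x₀)) hfx₀)) from hι)]
    refine GermSpace.ext_heq rfl ?_
    rw [hf.pushGerm_ofHeight hc₀ hx₀ he₀ hfx₀ hι hcomp]
    exact heq_of_eq rfl
  have hlifts : hf.pushGerm ∘ Γ' = GermSpace.postcomp ι ∘ Γ := by
    refine (F.isCoveringMap_proj).eq_of_comp_eq (hf.continuous_pushGerm.comp Γ'.continuous)
      (GermSpace.continuous_postcomp_comp Γ fun s ↦ by rw [hlevΓ s]; exact hι) ?_ 0 ?_
    · funext s
      show leafMap F' F f (Γ' s).proj = (GermSpace.postcomp ι (Γ s)).proj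
      rw [GermSpace.proj_postcomp]
      have h₁ := congr_fun ((F'.isCoveringMap_proj).liftPath_lifts γ
        (GermSpace.ofHeight F' hc₀ (toLeafSpace x₀) hx₀) γ.source) s
      have h₂ := congr_fun ((F.isCoveringMap_proj).liftPath_lifts (γ.map hf.continuous_leafMap)
        (GermSpace.ofHeight F he₀ (leafMap F' F f (toLeafSpace x₀)) hfx₀)
        (γ.map hf.continuous_leafMap).source) s
      simp only [comp_apply] at h₁ h₂
      rw [h₁, h₂]
      rfl
    · show hf.pushGerm (Γ' 0) = GermSpace.postcomp ι (Γ 0)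
      rw [(F'.isCoveringMap_proj).liftPath_zero, (F.isCoveringMap_proj).liftPath_zero]
      exact hstart
  have hend : hf.pushGerm (Γ' 1) = GermSpace.postcomp ι (Γ 1) := congr_fun hlifts 1
  -- base points of the end germs
  have hproj' : (Γ' 1).proj = toLeafSpace x₀ :=
    (congr_fun ((F'.isCoveringMap_proj).liftPath_lifts γ
      (GermSpace.ofHeight F' hc₀ (toLeafSpace x₀) hx₀) γ.source) 1).trans γ.target
  have hpt' : ofLeafSpace (Γ' 1).pt = x₀ := congrArg ofLeafSpace hproj'
  have hproj : (Γ 1).proj = leafMap F' F f (toLeafSpace x₀) :=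
    (congr_fun ((F.isCoveringMap_proj).liftPath_lifts (γ.map hf.continuous_leafMap)
      (GermSpace.ofHeight F he₀ (leafMap F' F f (toLeafSpace x₀)) hfx₀)
      (γ.map hf.continuous_leafMap).source) 1).trans (γ.map hf.continuous_leafMap).target
  have hpt : ofLeafSpace (Γ 1).pt = f x₀ := congrArg ofLeafSpace hproj
  -- the end germs: `Γ' 1 = ψ' ∘ h_{c₀}`, `Γ 1 = ψ ∘ h_{e₀}`
  have h1' : (Γ' 1).germ = ↑(ψ' ∘ height c₀) := by
    have h := F'.writeGerm_holonomyGerm hc₀ hx₀ (Path.Homotopic.Quotient.mk γ) hc₀ hx₀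
    rw [hψ', writeGerm_coe, F'.continuation_mk] at h
    exact h.symm
  have h1 : (Γ 1).germ = ↑(ψ ∘ height e₀) := by
    have h := F.writeGerm_holonomyGerm he₀ hfx₀
      (Path.Homotopic.Quotient.mk (γ.map hf.continuous_leafMap)) he₀ hfx₀
    rw [hψ, writeGerm_coe, F.continuation_mk] at h
    exact h.symm
  -- the pushed end germ is `(ψ' ∘ ι) ∘ h_{e₀}`
  have hpush : (hf.pushGerm (Γ' 1)).germ = ↑((ψ' ∘ ι) ∘ height e₀) := by
    refine hf.pushGerm_germ_eq_coe _ ?_ ?_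
    · rw [hpt']
      refine F.isDistinguishedGerm_comp_height he₀ hfx₀ (IsHomeoGermAt.comp ?_ hι)
      rwa [hιt]
    · rw [h1', Germ.coe_eq, hpt']
      filter_upwards [hcomp] with y hy
      simp only [comp_apply] at hy ⊢
      rw [hy]
  -- read both end germs through `e₀` at the height of `f x₀`
  have hz₁ : ofLeafSpace (hf.pushGerm (Γ' 1)).pt ∈ plaque e₀ (e₀ (f x₀)).2 := by
    show f (ofLeafSpace (Γ' 1).pt) ∈ plaque e₀ (e₀ (f x₀)).2
    rw [hpt']
    exact mem_plaque_self hfx₀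
  have hz₃ : ofLeafSpace (Γ 1).pt ∈ plaque e₀ (e₀ (f x₀)).2 := by
    rw [hpt]
    exact mem_plaque_self hfx₀
  have hz₂ : ofLeafSpace (GermSpace.postcomp ι (Γ 1)).pt ∈ plaque e₀ (e₀ (f x₀)).2 := by
    rw [GermSpace.postcomp_pt]
    exact hz₃
  have hread := readGerm_eq_of_eq he₀ hend hz₁ hz₂
  -- left-hand side
  have hL : F.readGerm he₀ hz₁ (hf.pushGerm (Γ' 1)).germ = ↑(ψ' ∘ ι) := by
    rw [hpush, F.readGerm_coe_comp_height he₀ hz₁]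
  -- right-hand side
  have hlev : IsHomeoGermAt ι (GermSpace.level (Γ 1)) := by rw [hlevΓ 1]; exact hι
  have hR₀ := readGerm_eq_of_eq he₀ (GermSpace.postcomp_eq_mk hlev) hz₂
    (show ofLeafSpace (⟨(Γ 1).pt, (Γ 1).germ.map ι,
      GermSpace.isDistinguishedGerm_map (Γ 1).isDist hlev⟩ : F.GermSpace).pt ∈
        plaque e₀ (e₀ (f x₀)).2 from hz₃)
  have hR : F.readGerm he₀ hz₂ (GermSpace.postcomp ι (Γ 1)).germ = ↑(ι ∘ ψ) := by
    rw [hR₀]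
    show F.readGerm he₀ hz₃ ((Γ 1).germ.map ι) = ↑(ι ∘ ψ)
    rw [h1, Germ.map_coe]
    exact F.readGerm_coe_comp_height he₀ hz₃ (ι ∘ ψ)
  rw [hL, hR, Germ.coe_eq] at hread
  exact hread

/-- **A leaf loop whose image has trivial holonomy has trivial holonomy.** [folklore] -/
theorem holonomyGerm_eq_id_of_map (hf : IsFoliatedMap F' F f) {x₀ : X}
    (hc₀ : c₀ ∈ F'.atlas) (hx₀ : x₀ ∈ c₀.source) (he₀ : e₀ ∈ F.atlas) (hfx₀ : f x₀ ∈ e₀.source)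
    {ι : ℝ → ℝ} (hι : IsHomeoGermAt ι (e₀ (f x₀)).2) (hcomp : height c₀ =ᶠ[𝓝 x₀] ι ∘ height e₀ ∘ f)
    (γ : Path (toLeafSpace x₀ : F'.LeafSpace) (toLeafSpace x₀))
    (hψ : F.holonomyGerm he₀ hfx₀ (Path.Homotopic.Quotient.mk (γ.map hf.continuous_leafMap))
      he₀ hfx₀ = ↑(id : ℝ → ℝ)) :
    F'.holonomyGerm hc₀ hx₀ (Path.Homotopic.Quotient.mk γ) hc₀ hx₀ = ↑(id : ℝ → ℝ) := by
  obtain ⟨ψ', -, hψ', -⟩ := F'.exists_isHomeoGermAt_holonomyGerm_eq hc₀ hx₀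
    (Path.Homotopic.Quotient.mk γ) hc₀ hx₀
  have key := hf.holonomyGerm_comp_eventuallyEq hc₀ hx₀ he₀ hfx₀ hι hcomp γ hψ hψ'
  obtain ⟨κ, hκ, hκt, -, hικ⟩ := hι.exists_inverse
  have hιt : ι (e₀ (f x₀)).2 = (c₀ x₀).2 := apply_height_eq hcomp
  rw [hψ', Germ.coe_eq]
  have hκT : Tendsto κ (𝓝 (c₀ x₀).2) (𝓝 (e₀ (f x₀)).2) := by
    have h := hκ.continuousAt
    rw [ContinuousAt, hκt, hιt] at h
    exact h
  rw [hιt] at hικ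
  filter_upwards [key.comp_tendsto hκT, hικ] with s hs hs'
  simp only [comp_apply, id_eq] at hs hs' ⊢
  rwa [hs'] at hs

/-- **A leaf loop whose image is null-homotopic in its leaf has trivial holonomy** (for a
foliated map: the holonomy of the image loop is trivial by the monodromy theorem, and holonomy
is natural). This is the step "the closed orbits of the induced foliation of the disc whose
images are homotopic to constants in their leaves have trivial holonomy" in the proof of the
existence of vanishing cycles (Camacho–Lins Neto, Ch. VII §2, Prop. 1).
[cite: CamachoLinsNeto1985, Ch. VII §2 Prop. 1] -/
theorem holonomyGerm_eq_id_of_map_homotopic_refl (hf : IsFoliatedMap F' F f) {x₀ : X}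
    (hc₀ : c₀ ∈ F'.atlas) (hx₀ : x₀ ∈ c₀.source) (he₀ : e₀ ∈ F.atlas) (hfx₀ : f x₀ ∈ e₀.source)
    {ι : ℝ → ℝ} (hι : IsHomeoGermAt ι (e₀ (f x₀)).2) (hcomp : height c₀ =ᶠ[𝓝 x₀] ι ∘ height e₀ ∘ f)
    (γ : Path (toLeafSpace x₀ : F'.LeafSpace) (toLeafSpace x₀))
    (hγ : (γ.map hf.continuous_leafMap).Homotopic (Path.refl _)) :
    F'.holonomyGerm hc₀ hx₀ (Path.Homotopic.Quotient.mk γ) hc₀ hx₀ = ↑(id : ℝ → ℝ) :=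
  hf.holonomyGerm_eq_id_of_map hc₀ hx₀ he₀ hfx₀ hι hcomp γ
    (F.holonomyGerm_mk_eq_id_of_homotopic_refl he₀ hfx₀ hγ)

end IsFoliatedMap

end Foliation

end Literature.Topology.FourManifolds
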